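import Summits.BirchSwinnertonDyer.BirchSwinnertonDyer.Theses.PrintX6
import Summits.BirchSwinnertonDyer.Rank1Residual.Supersingular.KobayashiMainConjecture
import Summits.BirchSwinnertonDyer.Rank1Residual.Supersingular.SignedRankZero
import Literature.NumberTheory.EllipticCurves.Kobayashi2003.SignedPAdicLFunctionConstantTermProofs
import Literature.NumberTheory.EllipticCurves.Kobayashi2003.SignedPAdicLFunctionExistenceProofs
import Literature.NumberTheory.EllipticCurves.Rank1Residual.PeriodUnitProofs
import Literature.NumberTheory.EllipticCurves.AnalyticRankOrderProofs
import Literature.NumberTheory.EllipticCurves.LeadingTermPPartProofs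
import HarnessLib

/-!
# Route `PrintX6`, crux `EisensteinHalfFiveLeRest` (stmt-BirchSwinnertonDyer-21116), line `log-witness`
# (bsd-idea-19, `Cruxes/EisensteinHalfFiveLeRest/Lines/log_witness.lean`, workfile d7ed02f3…):
# STUB 2 — the ENGINE `stub_missingLowerBoundAt_of_logSquare_X6` — BY NAME, modulo the route's
# published input pack `PublishedInputsX6` ALONE (no Kim 2026 fact, no Manin input)

HONEST FRAMING (width seat `bsd-line-x6-p2-w2` g4 under the x6-p2 LEAD lineage; D-0154 row 6): BSD is
not proved by any of this; no summit statement is proved by this seat; the crux stays OPEN; this file is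
a `--supports` helper and credits no registered stub (the line of record on the ledger is `kim_deficit`,
skeleton 9b5fcac7…; `log_witness` is published as a crux workfile only, W-79). What it shows, kernel
checked: the SECOND stub of the `log-witness` skeleton — exactly the registered text of
`LogWitness.stub_missingLowerBoundAt_of_logSquare_X6` — follows from the nine-conjunct route input
`PublishedInputsX6` (item stmt-BirchSwinnertonDyer-19289's pack; all conjuncts refereed print, 9/9 PA'd),
of which only FOUR conjuncts are used: the Néron/newform period unit at `p ≥ 5` (conjunct 4,
`realPeriodRat_eq_unit_mul_plusPeriod`), modularity as parametrisation data (conjunct 7,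
`nonempty_modularParametrizationData`), the entire continuation of `L(E,s)` (conjunct 8,
`hasEntireLFunction_rat`) and Gross–Zagier–Kolyvagin (conjunct 9,
`rank_eq_analyticRank_of_analyticRank_le_one`). Everything else is a tree THEOREM: Pollack's `L_p^±`
exist and are non-zero (`Kobayashi2003.exists_ne_zero_and_isSignedPAdicLFunction`, from
`pollack_exists_plusMinusPAdicLFunction_holds`), their constant terms are `c_ε · [0]⁺_f` with `p ∤ c_ε`
(`IsSignedPAdicLFunction.exists_constantCoeff_eq`; `c_1 = 2`, `c_{-1} = p − 1`; Kobayashi 2003 (3.6),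
Pollack 2003 Prop. 6.18), `L(E,1) = [0]⁺_f · Ω⁺_f` (`IsNewformOf.entireLFunction_one_eq`),
`#Ш_an = (L(E,1)/Ω_E) · #tors² / ∏ c_ℓ` in analytic rank `0` (`shaAn_eq_of_analyticRank_eq_zero`) and
`p ∤ #E(ℚ)_tors` at an irreducible prime (`padicValRat_shaAn_witness`); on X6 at `p ≥ 5`, `a_p = 0`
(`ClassX6.frobeniusTrace_eq_zero`) and `E[p]` is irreducible (`ClassX6.irr`).

## The dictionary (why stub 2 is bookkeeping)

For the newform `f` of `E = W`, an odd good supersingular `p` with `a_p = 0`, `E[p]` irreducible,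
`p ≥ 5`, and ANY `L ∈ Λ = ℤ_p⟦T⟧` carrying Kobayashi's label `ε` (`IsSignedPAdicLFunction f p ε L`):
`L(0) = c_ε · [0]⁺_f` in `ℚ_p` with `p ∤ c_ε`, `[0]⁺_f = L(E,1)/Ω⁺_f`, `Ω_E = u · Ω⁺_f` with `|u|_p = 1`;
hence with `t := L(E,1)/Ω_E = [0]⁺_f / u ∈ ℚ`:

  `L(E,1) ≠ 0 ⟹ L(0) ≠ 0` and **`ord_p t = v_p(L(0))`** (the `ℕ`-valued valuation of `L(0) ∈ ℤ_p`)

(§1, `exists_lRatio_padicValRat_eq_valuation_constantCoeff`), and since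
`ord_p #Ш_an = ord_p t − ord_p ∏ c_ℓ` (no `p`-torsion), any bound `v_p(L(0)) ≤ ord_p ∏ c_ℓ + ord_p #Ш`
is literally `Typed.MissingLowerBoundAt W p` (§2, `missingLowerBoundAt_of_valuation_constantCoeff_le`).
Stub 2's hypothesis, instantiated at the datum's newform (pack conjunct 7) and at Pollack's pair
`(L₁, L₂) = (L_p^{ε=1}, L_p^{ε=−1})` (tree existence theorem), supplies `s ≤ ord_p #Ш` with
`m ≤ s + ord_p ∏ c_ℓ` for every `m` with `p^m ∣ L₁(0)`; taking `m := v_p(L₁(0))` (`p^{v_p(x)} ∣ x` for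
`x ≠ 0`, `PadicInt.unitCoeff_spec`) gives the bound (§3). §4 re-keys §3 to the route currency
`PublishedInputsX6 → ⟨stub 2 text verbatim⟩`.

Compared with the line of record: `kim_deficit`'s engine (stub 2 there = stub 4 here) needs, beyond the
pack, Kim, Amer. J. Math. 148 (2026) Thm. 1.8 (6) and Mazur's Manin corollary (landings p608837 /
p609432 / p610149 / p610268); the `log-witness` engine needs NOTHING beyond the pack. The line's open
content is therefore exactly its stubs 1 (Cassels–Tate square of the log-deficiency, print) and 3 (the
dichotomy, open), as its card says.

## Contents

* §1 `exists_lRatio_padicValRat_eq_valuation_constantCoeff` — per pair, either sign: `∃ t ∈ ℚ^×`,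
  `L(E,1)/Ω_E = t`, `L(0) ≠ 0`, `ord_p t = v_p(L(0))`.
* §2 `missingLowerBoundAt_of_valuation_constantCoeff_le` — per pair, either sign:
  `v_p(L(0)) ≤ ord_p ∏ c_ℓ + ord_p #Ш ⟹ MissingLowerBoundAt W p`.
* §3 `stub_missingLowerBoundAt_of_logSquare_X6_of_facts` — the registered stub-2 text of the
  `log-witness` line from the four named facts (displayed).
* §4 `stub_missingLowerBoundAt_of_logSquare_X6_of_publishedInputsX6` — the same from `PublishedInputsX6`.

References: [Kobayashi2003] Thm. 3.2, (3.6) (p. 7); [Pollack2003] Thm. 5.6, Prop. 6.18;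
[MazurTateTeitelbaum1986Invent] §I.8 (8.6); [GreenbergVatsal2000] Rem. 3.4; [Mazur1978] Cor. 4.1;
[Miller2011LMS] Def. 1.1.
-/

set_option autoImplicit false

set_option linter.dupNamespace false

noncomputable section

open scoped Classical MatrixGroups ModularForm

open CongruenceSubgroup WeierstrassCurve Literature.NumberTheory.EllipticCurves
  Literature.NumberTheory.EllipticCurves.ModularForms
  Literature.NumberTheory.EllipticCurves.Rank1Residual
  Literature.NumberTheory.EllipticCurves.Rank1Residual.Typed
  Summit.BirchSwinnertonDyer.Rank1Residual.Supersingular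

namespace Summit.BirchSwinnertonDyer.BirchSwinnertonDyer.Theorems.PrintX6.LogWitness

/-! ## §1. The constant term of `L_p^ε` and `L(E,1)/Ω_E` have the same `p`-adic valuation -/

/-- **Per pair, either sign: `ord_p (L(E,1)/Ω_E) = v_p(L_p^ε(0))`.** For `W` globally minimal with
good reduction at a prime `p ≥ 5` with `a_p = 0`, `E[p]` irreducible and `L(E,1) ≠ 0`, `f` a newform of
`W` (any level), and any `L ∈ Λ` with Kobayashi's label `ε` (`IsSignedPAdicLFunction f p ε L`), granted
the period-unit fact `hper` (`Ω_E = u·Ω⁺_f`, `|u|_p = 1`): there is a non-zero rational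
`t = L(E,1)/Ω_E` with `L(0) ≠ 0` and `ord_p t = v_p(L(0))`. Chain: `L(0) = c_ε·[0]⁺_f`, `p ∤ c_ε`
(Kobayashi (3.6) / Pollack Prop. 6.18, tree theorem), `L(E,1) = [0]⁺_f·Ω⁺_f`, `t = [0]⁺_f/u`.
[cite: Kobayashi2003, (3.6) (p. 7)] [cite: Pollack2003, Prop. 6.18]
[cite: MazurTateTeitelbaum1986Invent, §I.8 (8.6)] [cite: GreenbergVatsal2000, Rem. 3.4] -/
theorem exists_lRatio_padicValRat_eq_valuation_constantCoeff
    (W : WeierstrassCurve ℚ) [W.IsElliptic] [W.IsGloballyMinimal] (p : ℕ) [Fact p.Prime]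
    (hper : realPeriodRat_eq_unit_mul_plusPeriod)
    (hp5 : 5 ≤ p) (hgood : W.HasGoodReductionAtPrime p) (hap : W.frobeniusTrace p = 0)
    (hirr : W.HasIrreducibleModPGaloisRep p) (hL : W.entireLFunction 1 ≠ 0)
    {N : ℕ} [NeZero N] {f : CuspForm (Gamma0 N) 2} (hf : IsNewformOf W f)
    {ε : ℤˣ} {L : IwasawaAlgebra p} (hLε : Kobayashi2003.IsSignedPAdicLFunction f p ε L) :
    ∃ t : ℚ, t ≠ 0 ∧ W.entireLFunction 1 / (W.realPeriodRat : ℂ) = (t : ℂ) ∧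
      PowerSeries.constantCoeff L ≠ 0 ∧
      padicValRat p t = ((PowerSeries.constantCoeff L).valuation : ℤ) := by
  have hpP : p.Prime := Fact.out
  have hp2 : p ≠ 2 := by omega
  -- the `L`-value: `L(E,1) = [0]⁺_f · Ω⁺_f`, so `[0]⁺_f ≠ 0`
  set s : ℚ := ratPlusSymbol f 0 with hs_def
  have hLval : W.entireLFunction 1 = (((s : ℝ) * plusPeriod f : ℝ) : ℂ) := hf.entireLFunction_one_eq
  have hs0 : s ≠ 0 := by
    intro h0
    apply hL
    rw [hLval, h0]
    simp
  -- the constant term: `L(0) = c · [0]⁺_f` in `ℚ_p`, `p ∤ c`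
  obtain ⟨c, hpc, hL0⟩ := hLε.exists_constantCoeff_eq hp2 hf hgood hap
  have hc0 : c ≠ 0 := by
    rintro rfl
    exact hpc (dvd_zero p)
  have hcs0 : (c : ℚ) * s ≠ 0 := mul_ne_zero (by exact_mod_cast hc0) hs0
  -- the period unit: `Ω_E = u · Ω⁺_f`, `|u|_p = 1`
  obtain ⟨u, hu1, hΩ⟩ := hper W p hp5 hgood hirr f hf
  have hu0 : u ≠ 0 := by
    rintro rfl
    simp at hu1
  have hΩpos : 0 < W.realPeriodRat := W.realPeriodRat_pos_holds
  have hΩf0 : plusPeriod f ≠ 0 := by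
    intro h0
    rw [h0, mul_zero] at hΩ
    exact hΩpos.ne' hΩ
  refine ⟨s / u, div_ne_zero hs0 hu0, ?_, ?_, ?_⟩
  · -- `L(E,1)/Ω_E = [0]⁺_f · Ω⁺_f / (u · Ω⁺_f) = [0]⁺_f / u`
    have hΩfC : ((plusPeriod f : ℝ) : ℂ) ≠ 0 := Complex.ofReal_ne_zero.mpr hΩf0
    rw [hLval, hΩ]
    push_cast
    rw [mul_div_mul_right _ _ hΩfC]
  · -- `L(0) ≠ 0` since `c · [0]⁺_f ≠ 0`
    intro h0
    rw [h0, PadicInt.coe_zero] at hL0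
    exact hcs0 (by exact_mod_cast hL0.symm)
  · -- valuations: `v_p(L(0)) = ord_p c + ord_p [0]⁺_f = ord_p [0]⁺_f = ord_p ([0]⁺_f / u)`
    have hv := congrArg Padic.valuation hL0
    rw [PadicInt.valuation_coe, Padic.valuation_ratCast,
      padicValRat.mul (by exact_mod_cast hc0) hs0, padicValRat.of_nat,
      padicValNat.eq_zero_of_not_dvd hpc, Nat.cast_zero, zero_add] at hv
    rw [padicValRat.div hs0 hu0, padicValRat_eq_zero_of_norm_ratCast_eq_one hu1, sub_zero, hv]

/-! ## §2. A valuation bound on `L_p^ε(0)` IS the Eisenstein half at the pair -/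

/-- **Per pair, either sign: `v_p(L_p^ε(0)) ≤ ord_p ∏ c_ℓ + ord_p #Ш ⟹ MissingLowerBoundAt W p`.**
Under the hypotheses of `exists_lRatio_padicValRat_eq_valuation_constantCoeff` and GZK (`hGZK`:
rank `0`, `Reg = 1`, so `#Ш_an = (L(E,1)/Ω_E)·#tors²/∏c_ℓ`; `p ∤ #tors` by irreducibility), a bound
`v_p(L(0)) ≤ ord_p ∏ c_ℓ + ord_p #Ш(E/ℚ)` for SOME `L` with a Kobayashi label gives
`ord_p #Ш_an ≤ ord_p #Ш`. [cite: Kobayashi2003, (3.6) (p. 7)] [cite: Miller2011LMS, Def. 1.1] -/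
theorem missingLowerBoundAt_of_valuation_constantCoeff_le
    (W : WeierstrassCurve ℚ) [W.IsElliptic] [W.IsGloballyMinimal] (p : ℕ) [Fact p.Prime]
    (hper : realPeriodRat_eq_unit_mul_plusPeriod)
    (hGZK : rank_eq_analyticRank_of_analyticRank_le_one)
    (hp5 : 5 ≤ p) (hgood : W.HasGoodReductionAtPrime p) (hap : W.frobeniusTrace p = 0)
    (hirr : W.HasIrreducibleModPGaloisRep p) (hL : W.entireLFunction 1 ≠ 0)
    {N : ℕ} [NeZero N] {f : CuspForm (Gamma0 N) 2} (hf : IsNewformOf W f)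
    {ε : ℤˣ} {L : IwasawaAlgebra p} (hLε : Kobayashi2003.IsSignedPAdicLFunction f p ε L)
    (hle : (PowerSeries.constantCoeff L).valuation ≤
      padicValNat p W.tamagawaProduct + padicValNat p W.shaOrder) :
    MissingLowerBoundAt W p := by
  obtain ⟨t, ht0, ht, -, hval⟩ :=
    exists_lRatio_padicValRat_eq_valuation_constantCoeff W p hper hp5 hgood hap hirr hL hf hLε
  have hr : W.analyticRank = 0 := analyticRank_eq_zero_of_entireLFunction_one_ne_zero W hL
  refine ⟨t * (W.torsionOrder : ℚ) ^ 2 / (W.tamagawaProduct : ℚ),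
    shaAn_eq_of_analyticRank_eq_zero W hGZK hr ht, ?_⟩
  rw [padicValRat_shaAn_witness W p hirr ht0, hval]
  have hle' : ((PowerSeries.constantCoeff L).valuation : ℤ) ≤
      (padicValNat p W.tamagawaProduct : ℤ) + padicValNat p W.shaOrder := by
    exact_mod_cast hle
  linarith

/-! ## §3. Stub 2 of the `log-witness` line, verbatim, from four named facts -/

/-- **STUB 2 of line `log-witness` — `LogWitness.stub_missingLowerBoundAt_of_logSquare_X6`, its
registered text VERBATIM after the four displayed binders — from refereed print only**: the period
unit at `p ≥ 5` (`hper`), modularity as parametrisation data (`hmod`), the entire continuation of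
`L(E,s)` (`hmod'`) and GZK (`hGZK`). Proof: on X6 at `p ≥ 5`, `a_p = 0` and `E[p]` is irreducible;
`r_an = 0` gives `L(E,1) ≠ 0`; instantiate the hypothesis at the newform `f := D.f` of a
parametrisation datum and at Pollack's `L_p^{ε = 1}`, `L_p^{ε = −1}` (tree existence theorem); with
`m := v_p(L₁(0))` (`p^m ∣ L₁(0)` by `PadicInt.unitCoeff_spec`) it yields
`v_p(L₁(0)) ≤ s + ord_p ∏c_ℓ ≤ ord_p #Ш + ord_p ∏c_ℓ`, and §2 concludes. No Kim fact, no Manin input.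
[cite: Kobayashi2003, Thm. 3.2 and (3.6) (p. 7)] [cite: Pollack2003, Thm. 5.6 and Prop. 6.18]
[cite: Miller2011LMS, Def. 1.1] -/
theorem stub_missingLowerBoundAt_of_logSquare_X6_of_facts
    (hper : realPeriodRat_eq_unit_mul_plusPeriod)
    (hmod : nonempty_modularParametrizationData)
    (hmod' : hasEntireLFunction_rat)
    (hGZK : rank_eq_analyticRank_of_analyticRank_le_one) :
    ∀ (W : WeierstrassCurve ℚ) [W.IsElliptic] [W.IsGloballyMinimal] (p : ℕ) [Fact p.Prime],
      5 ≤ p → ClassX6 W p → W.analyticRank = 0 →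
      (∀ [NeZero (W.conductorNorm ℤ)] (f : CuspForm (Gamma0 (W.conductorNorm ℤ)) 2), IsNewformOf W f →
        ∀ (L₁ L₂ : IwasawaAlgebra p), Kobayashi2003.IsSignedPAdicLFunction f p 1 L₁ →
          Kobayashi2003.IsSignedPAdicLFunction f p (-1) L₂ →
          ∃ s : ℕ, (∀ m : ℕ, (p : ℤ_[p]) ^ m ∣ PowerSeries.constantCoeff L₁ →
              m ≤ s + padicValNat p W.tamagawaProduct) ∧
            s ≤ padicValNat p W.shaOrder) →
      MissingLowerBoundAt W p := by
  intro W _ _ p _ hp5 hX hr0 H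
  have hpP : p.Prime := Fact.out
  have hp2 : p ≠ 2 := by omega
  have hgood : W.HasGoodReductionAtPrime p := hX.1.1
  have hap : W.frobeniusTrace p = 0 := ClassX6.frobeniusTrace_eq_zero W p hp2 hX
  have hirr : W.HasIrreducibleModPGaloisRep p := ClassX6.irr W p hp2 hX
  have hL : W.entireLFunction 1 ≠ 0 := (W.analyticRank_eq_zero_iff_holds (hmod' W)).1 hr0
  -- modularity: a newform `f` of `E` at level `N_E`
  haveI : NeZero (W.conductorNorm ℤ) := ⟨(W.conductorNorm_pos_holds).ne'⟩
  obtain ⟨Dm⟩ := hmod W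
  have hf : IsNewformOf W Dm.f := Dm.isNewformOf
  -- Pollack's pair in Kobayashi's labelling (tree existence theorem)
  obtain ⟨L₁, -, hL₁⟩ := Kobayashi2003.exists_ne_zero_and_isSignedPAdicLFunction hp2 hf hgood hap 1
  obtain ⟨L₂, -, hL₂⟩ :=
    Kobayashi2003.exists_ne_zero_and_isSignedPAdicLFunction hp2 hf hgood hap (-1)
  -- the witnessed inequalities at this newform and this pair
  obtain ⟨s, hs, hsSha⟩ := H Dm.f hf L₁ L₂ hL₁ hL₂
  obtain ⟨t, -, -, hc0, -⟩ :=
    exists_lRatio_padicValRat_eq_valuation_constantCoeff W p hper hp5 hgood hap hirr hL hf hL₁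
  -- `p^{v_p(L₁(0))} ∣ L₁(0)`
  have hdvd : (p : ℤ_[p]) ^ (PowerSeries.constantCoeff L₁).valuation ∣
      PowerSeries.constantCoeff L₁ :=
    Dvd.intro_left _ (PadicInt.unitCoeff_spec hc0).symm
  have hm := hs _ hdvd
  exact missingLowerBoundAt_of_valuation_constantCoeff_le W p hper hGZK hp5 hgood hap hirr hL hf
    hL₁ (by omega)

/-! ## §4. The same in the route's currency `PublishedInputsX6` -/

/-- **STUB 2 of line `log-witness` BY NAME from the route input `PublishedInputsX6` alone**
(conjuncts 4, 7, 8, 9 used: period unit at `p ≥ 5`, modular parametrisation data, entire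
`L`-function, GZK; conjuncts 1–3, 5, 6 unused). The text after `PublishedInputsX6 →` is the registered
signature of `LogWitness.stub_missingLowerBoundAt_of_logSquare_X6` verbatim. Conditional-result on the
pack (a route item, stmt-BirchSwinnertonDyer-19289, refereed print); credits no stub (the line is a
workfile, not the skeleton of record); the crux and BSD stay open.
[cite: Kobayashi2003, Thm. 3.2 and (3.6) (p. 7)] [cite: Pollack2003, Prop. 6.18] [cite: Miller2011LMS, Def. 1.1] -/
theorem stub_missingLowerBoundAt_of_logSquare_X6_of_publishedInputsX6
    (hPub : Summit.BirchSwinnertonDyer.BirchSwinnertonDyer.Theses.PrintX6.PublishedInputsX6) :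
    ∀ (W : WeierstrassCurve ℚ) [W.IsElliptic] [W.IsGloballyMinimal] (p : ℕ) [Fact p.Prime],
      5 ≤ p → ClassX6 W p → W.analyticRank = 0 →
      (∀ [NeZero (W.conductorNorm ℤ)] (f : CuspForm (Gamma0 (W.conductorNorm ℤ)) 2), IsNewformOf W f →
        ∀ (L₁ L₂ : IwasawaAlgebra p), Kobayashi2003.IsSignedPAdicLFunction f p 1 L₁ →
          Kobayashi2003.IsSignedPAdicLFunction f p (-1) L₂ →
          ∃ s : ℕ, (∀ m : ℕ, (p : ℤ_[p]) ^ m ∣ PowerSeries.constantCoeff L₁ →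
              m ≤ s + padicValNat p W.tamagawaProduct) ∧
            s ≤ padicValNat p W.shaOrder) →
      MissingLowerBoundAt W p := by
  obtain ⟨-, -, -, hper, -, -, hmod, hmod', hGZK⟩ := hPub
  exact stub_missingLowerBoundAt_of_logSquare_X6_of_facts hper hmod hmod' hGZK

end Summit.BirchSwinnertonDyer.BirchSwinnertonDyer.Theorems.PrintX6.LogWitness

end
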